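import Mathlib
import HarnessLib
import Summits.KontsevichZagierPeriods.KontsevichZagierPeriods.Theorems.MzvKernelInKZTwoPosetsCubicalChart
import Summits.KontsevichZagierPeriods.KontsevichZagierPeriods.Theorems.FurushoPentagonHoffmanRelationInKZCubicalTransportAux
import Summits.KontsevichZagierPeriods.KontsevichZagierPeriods.Theorems.LinRedNormalFormDihedralNormalFormStubNonSimpleReductionAux3

/-!
# Dihedral reflection of cubical atoms, IV: the move (three changes of variables)

Sequel of `…StubNonSimpleReductionAux3` (crux `DihedralNormalForm`, stmt-KontsevichZagierPeriods-3912,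
line `torus-descent-sum-shadow`, stub `stub_nonSimpleReduction`). The two pull-back identities
(the atom is its `C⁻¹`-pullback times the Jacobian; the `σ`-reflected pullback times the Jacobian is
the reflected atom — the reflection identity of part II) and the theorem
`dihedralReflection_of_nonneg`: the reflection `S = C⁻¹ ∘ σ ∘ C` as three `KZ.changeOfVariablesRel`
moves (cube → simplex along the cubical chart by `monomialChart_transport`, the affine involution
`σ` of the simplex with `|det| = 1`, simplex → cube), so that an atom
`[□ᵏ, q·xᵃ·∏_{i≤j}(1 - x_i⋯x_j)^{e i j}]` is congruent modulo `KZ.relations` to the atom with the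
reflected exponents `a' l = (k-1-l) + Σ_{I ⊆ [0,k-1-l]} e_I`, `e' i j = e (k-j) (k-i)` (`i ≥ 1`),
`e' 0 j = a(k-1-j) − [j ≥ 1](a(k-j) + 1 + Σ_{q ≥ k-j} e (k-j) q)`, under the hypothesis `a' ≥ 0`
(a consequence of absolute convergence, not proved here).
-/

noncomputable section

namespace Summit.KontsevichZagierPeriods.DihedralNormalForm.TorusDescent

open Finset Real Set MeasureTheory MvPolynomial
open Literature.NumberTheory.Transcendental
open Summit.KontsevichZagierPeriods.MzvKernelInKZ.TwoPosets (cube pprod cubicalMap image_cubicalMap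
  injOn_cubicalMap isSemialgebraic_cube prod_prod_erase_filter_le jacobian_pos cubicalMap_mem_simplex)
open Summit.KontsevichZagierPeriods.MzvKernelInKZ.Negative (simplex simplex_eq_openOrderedSimplex)
open Summit.KontsevichZagierPeriods.FurushoPentagon.HoffmanRelationInKZ (monomialChart_transport
  hasFDerivAt_monomialChart det_monomialChart)

variable {k : ℕ}
variable (T : ℕ → (Fin k → ℝ) → ℝ) (I : Fin k → Fin k → (Fin k → ℝ) → ℝ)
  (A : (Fin k → ℕ) → (Fin k → Fin k → ℤ) → (Fin k → ℝ) → ℝ) (τ : Fin k → Fin k)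
  (E0 : (Fin k → ℕ) → (Fin k → Fin k → ℤ) → Fin k → ℤ) (E1 : (Fin k → Fin k → ℤ) → Fin k → Fin k → ℤ)
  (eP : (Fin k → ℕ) → (Fin k → Fin k → ℤ) → Fin k → Fin k → ℤ) (AF : (Fin k → Fin k → ℤ) → Fin k → ℤ)
  (σ Cinv : (Fin k → ℝ) → (Fin k → ℝ))

/-! ### The two pull-back identities -/

/-- On the open cube the atom is its `C⁻¹`-pullback times the Jacobian:
`q·A(C⁻¹(C y)) · (∏ᵢ (C y)_{i-1})⁻¹ · ∏ⱼ yⱼ^{k-1-j} = q·A(y)`. -/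
theorem pullback_C
    (hT : ∀ (m : ℕ) (x : Fin k → ℝ), T m x = ∏ j : Fin k, if (j : ℕ) < m then x j else 1)
    (hCinv : ∀ (t : Fin k → ℝ) (i : Fin k), Cinv t i =
      t i / (if (i : ℕ) = 0 then 1 else t ⟨(i : ℕ) - 1, lt_of_le_of_lt (Nat.sub_le _ _) i.isLt⟩))
    (q : ℚ) (a : Fin k → ℕ) (e : Fin k → Fin k → ℤ) {y : Fin k → ℝ} (hy : ∀ i, y i ∈ Set.Ioo (0 : ℝ) 1) :
    (q : ℝ) * A a e (Cinv (cubicalMap k y)) * (∏ i : Fin k, (if (i : ℕ) = 0 then (1 : ℝ) else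
        (cubicalMap k y) ⟨(i : ℕ) - 1, lt_of_le_of_lt (Nat.sub_le _ _) i.isLt⟩))⁻¹ *
      (∏ j : Fin k, y j ^ (k - 1 - (j : ℕ))) = (q : ℝ) * A a e y := by
  have hy0 : ∀ i, y i ≠ 0 := fun i => (hy i).1.ne'
  have hC0 : ∀ i, cubicalMap k y i ≠ 0 := by
    intro i; rw [cubicalMap_eq_T T hT]; exact (T_pos T hT hy _).ne'
  rw [prod_prev_eq_jac T Cinv hT hCinv hC0, Cinv_cubicalMap T Cinv hT hCinv hy0]
  have hJ : (∏ j : Fin k, y j ^ (k - 1 - (j : ℕ))) ≠ 0 :=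
    Finset.prod_ne_zero_iff.mpr fun j _ => pow_ne_zero _ (hy0 j)
  field_simp

/-- On the open cube the `σ`-reflected pullback times the Jacobian is the reflected atom. -/
theorem pullback_σC
    (hT : ∀ (m : ℕ) (x : Fin k → ℝ), T m x = ∏ j : Fin k, if (j : ℕ) < m then x j else 1)
    (hI : ∀ (i j : Fin k) (x : Fin k → ℝ), I i j x = ∏ l : Fin k, if i ≤ l ∧ l ≤ j then x l else 1)
    (hA : ∀ (a : Fin k → ℕ) (e : Fin k → Fin k → ℤ) (x : Fin k → ℝ), A a e x =
      (∏ i : Fin k, x i ^ a i) * ∏ i : Fin k, ∏ j : Fin k, if i ≤ j then (1 - I i j x) ^ e i j else 1)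
    (hτ0 : ∀ m : Fin k, (m : ℕ) = 0 → τ m = m) (hτ1 : ∀ m : Fin k, (m : ℕ) ≠ 0 → ((τ m : Fin k) : ℕ) = k - m)
    (hE0 : ∀ (a : Fin k → ℕ) (e : Fin k → Fin k → ℤ) (j : Fin k), E0 a e j =
      (∑ l : Fin k, if (l : ℕ) + 1 + (j : ℕ) = k then (a l : ℤ) else 0) -
        (∑ l : Fin k, if (l : ℕ) + (j : ℕ) = k then (a l : ℤ) + 1 else 0) -
        ∑ i' : Fin k, ∑ j' : Fin k, if (i' : ℕ) + (j : ℕ) = k ∧ i' ≤ j' then e i' j' else 0)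
    (hE1 : ∀ (e : Fin k → Fin k → ℤ) (i j : Fin k), E1 e i j =
      ∑ i' : Fin k, ∑ j' : Fin k, if (i' : ℕ) + (j : ℕ) = k ∧ (j' : ℕ) + (i : ℕ) = k then e i' j' else 0)
    (heP : ∀ (a : Fin k → ℕ) (e : Fin k → Fin k → ℤ) (i j : Fin k), eP a e i j =
      if (i : ℕ) = 0 then E0 a e j else E1 e i j)
    (hAF : ∀ (e : Fin k → Fin k → ℤ) (l : Fin k), AF e l =
      ((k : ℤ) - 1 - (l : ℕ)) + ∑ i' : Fin k, ∑ j' : Fin k,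
        if i' ≤ j' ∧ (j' : ℕ) + (l : ℕ) + 1 ≤ k then e i' j' else 0)
    (hσ : ∀ (t : Fin k → ℝ) (i : Fin k), σ t i = 1 - t (Fin.rev i))
    (hCinv : ∀ (t : Fin k → ℝ) (i : Fin k), Cinv t i =
      t i / (if (i : ℕ) = 0 then 1 else t ⟨(i : ℕ) - 1, lt_of_le_of_lt (Nat.sub_le _ _) i.isLt⟩))
    (q : ℚ) (a : Fin k → ℕ) (e : Fin k → Fin k → ℤ) {y : Fin k → ℝ} (hy : ∀ i, y i ∈ Set.Ioo (0 : ℝ) 1)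
    (a' : Fin k → ℕ) (ha' : ∀ l, (a' l : ℤ) = AF e l) :
    (q : ℝ) * A a e (Cinv (σ (cubicalMap k y))) * (∏ i : Fin k, (if (i : ℕ) = 0 then (1 : ℝ) else
        (σ (cubicalMap k y)) ⟨(i : ℕ) - 1, lt_of_le_of_lt (Nat.sub_le _ _) i.isLt⟩))⁻¹ *
      (∏ j : Fin k, y j ^ (k - 1 - (j : ℕ))) = (q : ℝ) * A a' (eP a e) y := by
  have hne : ∀ i, σ (cubicalMap k y) i ≠ 0 := by
    cases k with
    | zero => intro i; exact i.elim0
    | succ n =>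
      have hs := σ_mem_simplex σ hσ (cubicalMap_mem_simplex (show y ∈ cube (n + 1) from hy))
      exact fun i => (hs.1 i).ne'
  have hz : ∀ i, Cinv (σ (cubicalMap k y)) i ∈ Set.Ioo (0 : ℝ) 1 := by
    cases k with
    | zero => intro i; exact i.elim0
    | succ n =>
      exact Cinv_mem_cube Cinv hCinv
        (σ_mem_simplex σ hσ (cubicalMap_mem_simplex (show y ∈ cube (n + 1) from hy)))
  rw [prod_prev_eq_jac T Cinv hT hCinv hne]
  have hid := reflection_identity T I A τ E0 E1 eP AF hT hI hA hτ0 hτ1 hE0 hE1 heP hAF hy hz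
    (fun m hm hmk => T_reflected T σ Cinv hT hσ hCinv hy m hm hmk) a e a' ha'
  have hJz : (∏ j : Fin k, (Cinv (σ (cubicalMap k y))) j ^ (k - 1 - (j : ℕ))) ≠ 0 :=
    Finset.prod_ne_zero_iff.mpr fun j _ => pow_ne_zero _ (hz j).1.ne'
  rw [← hid]
  field_simp

/-! ### The dihedral reflection move -/

/-- **Dihedral reflection of cubical atoms** (Brown's reflection `z ↦ 1 - z` of the marked points,
read in the cubical chart `tᵢ = x₀⋯xᵢ`: the composite `C⁻¹ ∘ σ ∘ C`, three change-of-variables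
moves of the KZ calculus). An atom `[□ᵏ, q·xᵃ·∏_{i≤j}(1 - x_i⋯x_j)^{e i j}]` is congruent modulo
`KZ.relations` to the atom with exponents `a' l = (k-1-l) + Σ_{I ⊆ [0,k-1-l]} e_I` and
`e' i j = e (k-j) (k-i)` (`i ≥ 1`), `e' 0 0 = a (k-1)`,
`e' 0 j = a (k-1-j) − a (k-j) − 1 − Σ_{q ≥ k-j} e (k-j) q` (`j ≥ 1`), provided the `a' l` are
non-negative (they are, by absolute convergence — Brown's criterion — not proved here). -/
theorem dihedralReflection_of_nonneg : ∀ (k : ℕ) (q : ℚ) (a : Fin k → ℕ) (e : Fin k → Fin k → ℤ) (s : Literature.NumberTheory.Transcendental.KZ.IntegralRep k), s.domain = {x : Fin k → ℝ | ∀ i, x i ∈ Set.Ioo (0:ℝ) 1} → Set.EqOn s.integrand (fun x => (q : ℝ) * ((∏ i : Fin k, x i ^ a i) * ∏ i : Fin k, ∏ j : Fin k, if i ≤ j then (1 - (∏ l : Fin k, if i ≤ l ∧ l ≤ j then x l else 1)) ^ e i j else 1)) s.domain → (∀ l : Fin k, (0 : ℤ) ≤ ((k : ℤ) - 1 - (l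 : ℕ)) + ∑ i' : Fin k, ∑ j' : Fin k, if i' ≤ j' ∧ (j' : ℕ) + (l : ℕ) + 1 ≤ k then e i' j' else 0) → ∃ (a' : Fin k → ℕ) (s' : Literature.NumberTheory.Transcendental.KZ.IntegralRep k), (∀ l : Fin k, ((a' l : ℕ) : ℤ) = ((k : ℤ) - 1 - (l : ℕ)) + ∑ i' : Fin k, ∑ j' : Fin k, if i' ≤ j' ∧ (j' : ℕ) + (l : ℕ) + 1 ≤ k then e i' j' else 0) ∧ s'.domain = {x : Fin k → ℝ | ∀ i, x i ∈ Set.Ioo (0:ℝ) 1} ∧ Set.EqOn s'.integrand (fun x => (q : ℝ) * ((∏ i : Fin k, x i ^ a' i) * ∏ i : Fin k, ∏ j : Fin k, if i ≤ j then (1 - (∏ l : Fin k, if i ≤ l ∧ l ≤ j then x l else 1)) ^ (if (i : ℕ) = 0 then ((∑ l : Fin k, if (l : ℕ) + 1 + (j : ℕ) = k then (a l : ℤ) else 0) - (∑ l : Fin k, if (l : ℕ) + (j : ℕ) = k then (a l : ℤ) + 1 else 0) - ∑ i' : Fin k, ∑ j' : Fin k, if (i' : ℕ) + (j : ℕ)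 = k ∧ i' ≤ j' then e i' j' else 0) else ∑ i' : Fin k, ∑ j' : Fin k, if (i' : ℕ) + (j : ℕ) = k ∧ (j' : ℕ) + (i : ℕ) = k then e i' j' else 0) else 1)) s'.domain ∧ Literature.NumberTheory.Transcendental.KZ.of s - Literature.NumberTheory.Transcendental.KZ.of s' ∈ Literature.NumberTheory.Transcendental.KZ.relations := by
  intro k q a e s hdom hint hpos
  classical
  -- the concrete data (instances of the variables of parts I–III)
  let T : ℕ → (Fin k → ℝ) → ℝ := fun m x => ∏ j : Fin k, if (j : ℕ) < m then x j else 1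
  let I : Fin k → Fin k → (Fin k → ℝ) → ℝ := fun i j x => ∏ l : Fin k, if i ≤ l ∧ l ≤ j then x l else 1
  let A : (Fin k → ℕ) → (Fin k → Fin k → ℤ) → (Fin k → ℝ) → ℝ := fun a e x =>
    (∏ i : Fin k, x i ^ a i) * ∏ i : Fin k, ∏ j : Fin k, if i ≤ j then (1 - I i j x) ^ e i j else 1
  let τ : Fin k → Fin k := fun m => if h : (m : ℕ) = 0 then m else ⟨k - m, by have := m.isLt; omega⟩
  let E0 : (Fin k → ℕ) → (Fin k → Fin k → ℤ) → Fin k → ℤ := fun a e j =>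
    (∑ l : Fin k, if (l : ℕ) + 1 + (j : ℕ) = k then (a l : ℤ) else 0) -
      (∑ l : Fin k, if (l : ℕ) + (j : ℕ) = k then (a l : ℤ) + 1 else 0) -
      ∑ i' : Fin k, ∑ j' : Fin k, if (i' : ℕ) + (j : ℕ) = k ∧ i' ≤ j' then e i' j' else 0
  let E1 : (Fin k → Fin k → ℤ) → Fin k → Fin k → ℤ := fun e i j =>
    ∑ i' : Fin k, ∑ j' : Fin k, if (i' : ℕ) + (j : ℕ) = k ∧ (j' : ℕ) + (i : ℕ) = k then e i' j' else 0
  let eP : (Fin k → ℕ) → (Fin k → Fin k → ℤ) → Fin k → Fin k → ℤ := fun a e i j =>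
    if (i : ℕ) = 0 then E0 a e j else E1 e i j
  let AF : (Fin k → Fin k → ℤ) → Fin k → ℤ := fun e l =>
    ((k : ℤ) - 1 - (l : ℕ)) + ∑ i' : Fin k, ∑ j' : Fin k,
      if i' ≤ j' ∧ (j' : ℕ) + (l : ℕ) + 1 ≤ k then e i' j' else 0
  let σ : (Fin k → ℝ) → (Fin k → ℝ) := fun t i => 1 - t (Fin.rev i)
  let Cinv : (Fin k → ℝ) → (Fin k → ℝ) := fun t i =>
    t i / (if (i : ℕ) = 0 then 1 else t ⟨(i : ℕ) - 1, lt_of_le_of_lt (Nat.sub_le _ _) i.isLt⟩)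
  have hT : ∀ (m : ℕ) (x : Fin k → ℝ), T m x = ∏ j : Fin k, if (j : ℕ) < m then x j else 1 :=
    fun _ _ => rfl
  have hI : ∀ (i j : Fin k) (x : Fin k → ℝ), I i j x = ∏ l : Fin k, if i ≤ l ∧ l ≤ j then x l else 1 :=
    fun _ _ _ => rfl
  have hA : ∀ (a : Fin k → ℕ) (e : Fin k → Fin k → ℤ) (x : Fin k → ℝ), A a e x = (∏ i : Fin k,
      x i ^ a i) * ∏ i : Fin k, ∏ j : Fin k, if i ≤ j then (1 - I i j x) ^ e i j else 1 :=
    fun _ _ _ => rfl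
  have hτ0 : ∀ m : Fin k, (m : ℕ) = 0 → τ m = m := fun m hm => by simp [τ, hm]
  have hτ1 : ∀ m : Fin k, (m : ℕ) ≠ 0 → ((τ m : Fin k) : ℕ) = k - m := fun m hm => by simp [τ, hm]
  have hE0 : ∀ (a : Fin k → ℕ) (e : Fin k → Fin k → ℤ) (j : Fin k), E0 a e j =
      (∑ l : Fin k, if (l : ℕ) + 1 + (j : ℕ) = k then (a l : ℤ) else 0) -
        (∑ l : Fin k, if (l : ℕ) + (j : ℕ) = k then (a l : ℤ) + 1 else 0) -
        ∑ i' : Fin k, ∑ j' : Fin k, if (i' : ℕ) + (j : ℕ) = k ∧ i' ≤ j' then e i' j' else 0 :=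
    fun _ _ _ => rfl
  have hE1 : ∀ (e : Fin k → Fin k → ℤ) (i j : Fin k), E1 e i j = ∑ i' : Fin k, ∑ j' : Fin k,
      if (i' : ℕ) + (j : ℕ) = k ∧ (j' : ℕ) + (i : ℕ) = k then e i' j' else 0 := fun _ _ _ => rfl
  have heP : ∀ (a : Fin k → ℕ) (e : Fin k → Fin k → ℤ) (i j : Fin k), eP a e i j =
      if (i : ℕ) = 0 then E0 a e j else E1 e i j := fun _ _ _ _ => rfl
  have hAF : ∀ (e : Fin k → Fin k → ℤ) (l : Fin k), AF e l = ((k : ℤ) - 1 - (l : ℕ)) +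
      ∑ i' : Fin k, ∑ j' : Fin k, if i' ≤ j' ∧ (j' : ℕ) + (l : ℕ) + 1 ≤ k then e i' j' else 0 :=
    fun _ _ => rfl
  have hσ : ∀ (t : Fin k → ℝ) (i : Fin k), σ t i = 1 - t (Fin.rev i) := fun _ _ => rfl
  have hCinv : ∀ (t : Fin k → ℝ) (i : Fin k), Cinv t i = t i / (if (i : ℕ) = 0 then 1 else
      t ⟨(i : ℕ) - 1, lt_of_le_of_lt (Nat.sub_le _ _) i.isLt⟩) := fun _ _ => rfl
  -- the reflected monomial exponents
  let a' : Fin k → ℕ := fun l => (AF e l).toNat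
  have ha' : ∀ l, (a' l : ℤ) = AF e l := fun l => Int.toNat_of_nonneg (hpos l)
  -- the given atom on the cube
  have hdom' : s.domain = cube k := hdom
  have hlit : (fun x : Fin k → ℝ => (q : ℝ) * ((∏ i : Fin k, x i ^ a i) * ∏ i : Fin k, ∏ j : Fin k,
      if i ≤ j then (1 - (∏ l : Fin k, if i ≤ l ∧ l ≤ j then x l else 1)) ^ e i j else 1)) =
      fun x => (q : ℝ) * A a e x := rfl
  rw [hlit] at hint
  have hA_sa : IsSemialgebraicFunOn ℚ (cube k) (fun x => (q : ℝ) * A a e x) := by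
    have := s.isSemialgebraicFunOn_integrand.congr hint
    rwa [hdom'] at this
  have hmeas : MeasurableSet (cube k) :=
    Literature.ModelTheory.ExponentialFields.IsSemialgebraic.measurableSet_holds (isSemialgebraic_cube k)
  have hA_int : IntegrableOn (fun x => (q : ℝ) * A a e x) (cube k) := by
    have := s.integrableOn.congr_fun hint (KZ.IntegralRep.measurableSet_domain_holds s)
    rwa [hdom'] at this
  -- monomial chart data
  let S : Fin k → Finset (Fin k) := fun i => Finset.univ.filter (fun j => j ≤ i)
  have hS : ∀ i : Fin k, ∀ j ∈ S i, j ≤ i := fun i j hj => (Finset.mem_filter.mp hj).2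
  have hS' : ∀ i : Fin k, i ∈ S i := fun i => Finset.mem_filter.mpr ⟨Finset.mem_univ _, le_rfl⟩
  have hC : ∀ y i, cubicalMap k y i = ∏ j ∈ S i, y j := fun _ _ => rfl
  have hCfun : (fun (y : Fin k → ℝ) (i : Fin k) => ∏ j ∈ S i, y j) = cubicalMap k := rfl
  have hJac : ∀ y ∈ cube k, |∏ i : Fin k, ∏ l ∈ (S i).erase i, y l| =
      ∏ j : Fin k, y j ^ (k - 1 - (j : ℕ)) := by
    intro y hy
    rw [prod_prod_erase_filter_le, abs_of_pos (jacobian_pos hy)]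
  -- the first simplex representation
  let h1 : (Fin k → ℝ) → ℝ := ((fun x => (q : ℝ) * A a e x) ∘ Cinv) *
    (fun t : Fin k → ℝ => (∏ i : Fin k, (if (i : ℕ) = 0 then (1 : ℝ) else
      t ⟨(i : ℕ) - 1, lt_of_le_of_lt (Nat.sub_le _ _) i.isLt⟩))⁻¹)
  have h1_apply : ∀ t, h1 t = (q : ℝ) * A a e (Cinv t) * (∏ i : Fin k, (if (i : ℕ) = 0 then (1 : ℝ)
      else t ⟨(i : ℕ) - 1, lt_of_le_of_lt (Nat.sub_le _ _) i.isLt⟩))⁻¹ := fun _ => rfl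
  have h1_sa : IsSemialgebraicFunOn ℚ (simplex k) h1 :=
    IsSemialgebraicFunOn.mul_holds (IsSemialgebraicFunOn.comp_isSemialgebraicMapOn_holds hA_sa
      (isSemialgebraicMapOn_Cinv Cinv hCinv) (fun t ht => Cinv_mem_cube Cinv hCinv ht))
      (isSemialgebraicFunOn_invJac k)
  have hmeasx : MeasurableSet (simplex k) :=
    Literature.ModelTheory.ExponentialFields.IsSemialgebraic.measurableSet_holds (isSemialgebraic_simplex k)
  have h1_int : IntegrableOn h1 (simplex k) := by
    have key := integrableOn_image_iff_integrableOn_abs_det_fderiv_smul volume hmeas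
      (fun y _ => (hasFDerivAt_monomialChart S y).hasFDerivWithinAt)
      (hCfun ▸ injOn_cubicalMap k) h1
    rw [hCfun, image_cubicalMap] at key
    refine key.mpr (hA_int.congr_fun (fun y hy => ?_) hmeas)
    rw [det_monomialChart S hS hS', hJac y hy, smul_eq_mul]
    show (q : ℝ) * A a e y = (∏ j : Fin k, y j ^ (k - 1 - (j : ℕ))) * h1 (cubicalMap k y)
    rw [h1_apply, ← pullback_C T A Cinv hT hCinv q a e hy]
    ring
  let S1 : KZ.IntegralRep k := ⟨simplex k, h1, isSemialgebraic_simplex k, h1_sa, h1_int⟩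
  -- the second simplex representation
  let h2 : (Fin k → ℝ) → ℝ := h1 ∘ σ
  have h2_sa : IsSemialgebraicFunOn ℚ (simplex k) h2 :=
    IsSemialgebraicFunOn.comp_isSemialgebraicMapOn_holds h1_sa (isSemialgebraicMapOn_σ σ hσ)
      (fun t ht => σ_mem_simplex σ hσ ht)
  have h2_int : IntegrableOn h2 (simplex k) := by
    have key := integrableOn_image_iff_integrableOn_abs_det_fderiv_smul volume hmeasx
      (fun t _ => (hasFDerivAt_σ σ hσ t).hasFDerivWithinAt) (injOn_σ σ hσ) h1
    rw [image_σ_simplex σ hσ] at key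
    refine ((key.mp h1_int).congr_fun (fun t _ => ?_) hmeasx)
    show |(ContinuousLinearMap.pi fun i : Fin k => -(ContinuousLinearMap.proj (R := ℝ)
      (φ := fun _ : Fin k => ℝ) (Fin.rev i))).det| • h1 (σ t) = h2 t
    rw [abs_det_minusRev, one_smul]
    rfl
  let S2 : KZ.IntegralRep k := ⟨simplex k, h2, isSemialgebraic_simplex k, h2_sa, h2_int⟩
  -- transports along the cubical chart
  have hT1 := monomialChart_transport S hS hS' (isSemialgebraic_cube k) (cubicalMap k) hC
    (injOn_cubicalMap k) (fun y => h1 (cubicalMap k y) * |∏ i : Fin k, ∏ l ∈ (S i).erase i, y l|)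
    h1 (fun y _ => rfl)
  have hT2 := monomialChart_transport S hS hS' (isSemialgebraic_cube k) (cubicalMap k) hC
    (injOn_cubicalMap k) (fun y => h2 (cubicalMap k y) * |∏ i : Fin k, ∏ l ∈ (S i).erase i, y l|)
    h2 (fun y _ => rfl)
  have hdomS : simplex k = cubicalMap k '' cube k := (image_cubicalMap k).symm
  have R1 : KZ.Equivalent s S1 := by
    refine hT1.2 s S1 hdom' (fun y hy => ?_) hdomS (fun _ _ => rfl)
    rw [hint (hdom'.symm ▸ hy)]
    show (q : ℝ) * A a e y = h1 (cubicalMap k y) * |∏ i : Fin k, ∏ l ∈ (S i).erase i, y l|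
    rw [hJac y hy, h1_apply, ← pullback_C T A Cinv hT hCinv q a e hy]
  obtain ⟨r, hrd, hri⟩ := hT2.1 S2 hdomS (fun _ _ => rfl)
  have R3 : KZ.Equivalent r S2 := hT2.2 r S2 hrd (by rw [hri]; exact fun _ _ => rfl) hdomS
    (fun _ _ => rfl)
  have R2 : KZ.of S1 - KZ.of S2 ∈ KZ.relations := by
    refine KZ.changeOfVariablesRel_subset_relations ⟨k, S1, S2, σ, fun _ =>
      (ContinuousLinearMap.pi fun i : Fin k => -(ContinuousLinearMap.proj (R := ℝ)
        (φ := fun _ : Fin k => ℝ) (Fin.rev i))),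
      isSemialgebraicMapOn_σ σ hσ, fun t _ => (hasFDerivAt_σ σ hσ t).hasFDerivWithinAt, injOn_σ σ hσ,
      (image_σ_simplex σ hσ).symm, fun t _ => ?_, rfl⟩
    show h1 t = h1 (σ (σ t)) * _
    rw [σ_σ σ hσ, abs_det_minusRev, mul_one]
  -- conclusion
  refine ⟨a', r, fun l => ha' l, hrd, ?_, ?_⟩
  · rw [hri, hrd]
    intro y hy
    show h1 (σ (cubicalMap k y)) * |∏ i : Fin k, ∏ l ∈ (S i).erase i, y l| = _
    rw [hJac y hy, h1_apply, pullback_σC T I A τ E0 E1 eP AF σ Cinv hT hI hA hτ0 hτ1 hE0 hE1 heP hAF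
      hσ hCinv q a e hy a' ha']
  · have h : KZ.of s - KZ.of r =
        (KZ.of s - KZ.of S1) + (KZ.of S1 - KZ.of S2) + -(KZ.of r - KZ.of S2) := by abel
    rw [h]
    exact add_mem (add_mem R1 R2) (neg_mem R3)


end Summit.KontsevichZagierPeriods.DihedralNormalForm.TorusDescent
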